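import Literature.RepresentationTheory.FiniteGroups.SymmetricGroupIsotypic
import Literature.RepresentationTheory.Semisimple.SubrepresentationEquiv
import Literature.NumberTheory.DiophantineGeometry.WordModelSelfDuality
import Literature.NumberTheory.DiophantineGeometry.GLHighestWeightMultiplicityProofs
import Literature.NumberTheory.DiophantineGeometry.GLPolynomialRepSemisimpleProofs
import HarnessLib

/-!
# The isotypic components of `𝔖ₙ` on `(ℂ^N)^{⊗n}` are generated by highest-weight vectors

Topic `Literature/RepresentationTheory/GeneralLinear`; Schur–Weyl duality, *span form*, in the
coordinate ("words") model `wordRep ℂ N n` of the tensor power `(ℂ^N)^{⊗n}`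
(`Literature.NumberTheory.DiophantineGeometry.TensorWordModel`), on which `𝔖ₙ` acts by permuting
the positions (`wordPermRep`) and `GL_N(ℂ)` by the Kronecker powers `g^{⊗n}` (`wordRep`), the two
actions commuting. For a partition `λ ⊢ n` let `P_λ = isotypicProj (wordPermRep ℂ N n) χ^λ` be the
isotypic projector of the Specht character `χ^λ` (`IsotypicProjector.lean`,
`SymmetricGroupIsotypic.lean`: `P_λ² = P_λ`, `P_λ P_μ = 0`, `∑_λ P_λ = 1`) and let
`HW_λ = highestWeightSpace (wordRep ℂ N n) (Weight.ofPartition N λ)` be the space of highest-weight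
vectors of weight `λ` (upper triangular Borel subgroup). PROVED here:

* `isotypicProj_apply_of_mem_highestWeightSpace`, `…_of_ne` — `P_λ = 1` on `HW_λ` and `P_μ = 0` on
  `HW_λ` for `μ ≠ λ` (`λ` with at most `N` parts): `HW_λ ≅ S^λ` as an `𝔖ₙ`-module
  (`spechtEquivHw`, `character_hwPermRep`) is irreducible with character `χ^λ`, and the isotypic
  projector of an irreducible representation is `1` or `0` according to the character
  (`isotypicProj_eq_id_of_character_eq`, `isotypicProj_eq_zero_of_character_ne`).
* `highestWeightSpace_ofPartition_eq_bot_of_lt` — `HW_λ = 0` if `λ` has more than `N` parts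
  (the truncated weight has size `< n`, while weights of `(ℂ^N)^{⊗n}` have size `n`).
* `range_isotypicProj_wordPermRep` — **the `λ`-isotypic component `P_λ (ℂ^N)^{⊗n}` is the linear
  span of the `GL_N`-translates `g · ξ` of the highest-weight vectors `ξ ∈ HW_λ`**, for every
  `λ ⊢ n`; in particular (`isotypicProj_wordPermRep_eq_zero_of_lt`) `P_λ = 0` when `λ` has more
  than `N` parts. This is the statement "`P_λ V^{⊗n} ≅ S_λ(V) ⊗ [λ]`, `S_λ(V)` generated by its
  highest-weight line, and `= 0` if `ℓ(λ) > dim V`" of Schur–Weyl duality (Fulton–Harris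
  Thm. 6.3 with §15.5; Christandl–Vrana–Zuiddam, J. Amer. Math. Soc. 36 (2023), §3.1 (sw)) in the
  form needed to turn the non-vanishing of an isotypic projection into the non-vanishing of a
  highest-weight covariant (CVZ Thm. 3.29/3.30).
  Proof of `⊇`: `P_λ` commutes with `GL_N` and fixes `HW_λ`. Proof of `⊆`: the fixed space
  `I_λ = {v | P_λ v = v}` is a `GL_N`-stable subspace, a rational representation, hence completely
  reducible (`isSemisimpleRepresentation_of_isRationalRep_holds`); a `GL_N`-stable complement `C`
  of the span `M_λ ⊆ I_λ` inside `I_λ`, if nonzero, contains a nonzero highest-weight vector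
  (`exists_mem_highestWeightSpace_of_le_comap`), whose weight is a partition `μ` with at most `N`
  parts (`exists_partition_of_highestWeightSpace_ne_bot`); `P_λ` fixes it, forcing `μ = λ`, so it
  lies in `HW_λ ⊆ M_λ`, contradicting `M_λ ∩ C = 0`. Hence `C = 0` and `I_λ = M_λ`.

## References

* W. Fulton, J. Harris, *Representation Theory. A First Course*, GTM 129 (1991), Thm. 6.3 (2),(4),
  Lemma 6.22, §15.5 (Thm. 15.47). [FultonHarrisGTM129]
* M. Christandl, P. Vrana, J. Zuiddam, *Universal points in the asymptotic spectrum of tensors*,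
  J. Amer. Math. Soc. 36 (2023) 31–79 = arXiv:1709.07851v3, §3.1, display (sw).
  [ChristandlVranaZuiddam2023]

## Mathlib and tree

Mathlib: `Representation.subrepresentation`, `Subrepresentation` (lattice, `toRepresentation`),
`Representation.IsSemisimpleRepresentation` (= `ComplementedLattice (Subrepresentation ρ)`),
`Submodule.span_induction`. Tree: `isotypicProj` with `isotypicProj_eq_id_of_character_eq`,
`isotypicProj_eq_zero_of_character_ne`, `comp_isotypicProj_of_forall_comm`,
`isotypicProj_isotypicProj_apply` (`IsotypicProjector.lean`); `isIrrChar_spechtCharacter`,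
`spechtCharacter_injective` (`SymmetricGroupIsotypic.lean`); `wordRep`, `wordPerm_wordRep`,
`wordRepEquiv` (`TensorWordModel`); `wordPermRep` (`SymmetricGroupRepsFinrankSpechtProofs`);
`hwPermRep`, `spechtEquivHw`, `character_hwPermRep` (`WordHighestWeightSpecht`);
`isPolynomialRep_wordRep`, `exists_mem_highestWeightSpace_of_le_comap`,
`exists_partition_of_highestWeightSpace_ne_bot` (`WordModelSelfDuality`);
`IsRationalRep.toRepresentation` (`GLHighestWeightMultiplicityProofs`);
`isSemisimpleRepresentation_of_isRationalRep_holds` (`GLPolynomialRepSemisimpleProofs`);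
`size_eq_of_hasHighestWeight_glTensorRep`, `Weight.size_ofPartition_holds`;
`Representation.isIrreducible_of_equiv` (`SubrepresentationEquiv`); `isIrreducible_spechtRep_holds`.
No new definitions: the span `M_λ` is written out as
`Submodule.span ℂ (Set.range fun p : GL × HW_λ => p.1 · p.2)` in every statement.
-/

noncomputable section

open scoped BigOperators

open Literature.NumberTheory.DiophantineGeometry
open Literature.RepresentationTheory.FiniteGroups
open Literature.RepresentationTheory.Semisimple

namespace Literature.RepresentationTheory.GeneralLinear

variable {N n : ℕ}

/-! ### Isotypic projectors on the highest-weight spaces `HW_λ ≅ S^λ` -/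

/-- The isotypic projector of the subrepresentation `HW_χ` of `𝔖ₙ` (`hwPermRep`) is the
restriction of the isotypic projector of the word model (same formula). [folklore] -/
theorem coe_isotypicProj_hwPermRep (χ : Weight (Fin N)) (φ : Equiv.Perm (Fin n) → ℂ)
    (w : highestWeightSpace (wordRep ℂ N n) χ) :
    ((isotypicProj (hwPermRep ℂ (D := n) χ) φ w : highestWeightSpace (wordRep ℂ N n) χ) :
        Word N n → ℂ) = isotypicProj (wordPermRep ℂ N n) φ (w : Word N n → ℂ) := by
  simp only [isotypicProj_apply, AddSubmonoidClass.coe_finsetSum, Submodule.coe_smul,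
    coe_hwPermRep_apply, wordPermRep_apply]

/-- `HW_λ((ℂ^N)^{⊗n})` is an irreducible `𝔖ₙ`-module for `λ` with at most `N` parts: it is
isomorphic to the Specht module `S^λ` (`spechtEquivHw`), which is irreducible
(`isIrreducible_spechtRep_holds`). [cite: FultonHarrisGTM129, Thm. 6.3 (2) with Lemma 6.22] -/
theorem isIrreducible_hwPermRep (μ : Nat.Partition n) (hμ : μ.parts.card ≤ N) :
    (hwPermRep ℂ (D := n) (Weight.ofPartition N μ)).IsIrreducible := by
  haveI : (spechtRep ℂ μ).IsIrreducible := isIrreducible_spechtRep_holds μ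
  exact Representation.isIrreducible_of_equiv (spechtEquivHw ℂ μ hμ)

/-- **`P_λ = 1` on `HW_λ`**: the isotypic projector of the Specht character `χ^λ` fixes every
highest-weight vector of weight `λ` (`λ ⊢ n` with at most `N` parts), since `HW_λ ≅ S^λ` is
irreducible with character `χ^λ`. [cite: FultonHarrisGTM129, Thm. 6.3 (2) with Lemma 6.22] -/
theorem isotypicProj_apply_of_mem_highestWeightSpace (μ : Nat.Partition n) (hμ : μ.parts.card ≤ N)
    {ξ : Word N n → ℂ} (hξ : ξ ∈ highestWeightSpace (wordRep ℂ N n) (Weight.ofPartition N μ)) :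
    isotypicProj (wordPermRep ℂ N n) (spechtCharacter ℂ μ) ξ = ξ := by
  haveI := isIrreducible_hwPermRep μ hμ
  have h := isotypicProj_eq_id_of_character_eq (hwPermRep ℂ (D := n) (Weight.ofPartition N μ))
    (character_hwPermRep ℂ μ hμ)
  have h' := congrArg
    (fun f : highestWeightSpace (wordRep ℂ N n) (Weight.ofPartition N μ) →ₗ[ℂ]
        highestWeightSpace (wordRep ℂ N n) (Weight.ofPartition N μ) =>
      ((f ⟨ξ, hξ⟩ : highestWeightSpace (wordRep ℂ N n) (Weight.ofPartition N μ)) : Word N n → ℂ)) h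
  simp only [LinearMap.id_apply, coe_isotypicProj_hwPermRep] at h'
  exact h'

/-- **`P_μ = 0` on `HW_λ` for `μ ≠ λ`** (`λ` with at most `N` parts): the isotypic projector of
`χ^μ` kills the irreducible `𝔖ₙ`-module `HW_λ ≅ S^λ` of character `χ^λ ≠ χ^μ`.
[cite: FultonHarrisGTM129, Thm. 6.3 (2) with Lemma 6.22] -/
theorem isotypicProj_apply_of_mem_highestWeightSpace_of_ne {μ μ' : Nat.Partition n} (hne : μ ≠ μ')
    (hμ' : μ'.parts.card ≤ N) {ξ : Word N n → ℂ}
    (hξ : ξ ∈ highestWeightSpace (wordRep ℂ N n) (Weight.ofPartition N μ')) :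
    isotypicProj (wordPermRep ℂ N n) (spechtCharacter ℂ μ) ξ = 0 := by
  haveI := isIrreducible_hwPermRep μ' hμ'
  have hchar : (hwPermRep ℂ (D := n) (Weight.ofPartition N μ')).character ≠ spechtCharacter ℂ μ := by
    rw [character_hwPermRep ℂ μ' hμ']
    exact fun h => hne (spechtCharacter_injective h).symm
  have h := isotypicProj_eq_zero_of_character_ne (hwPermRep ℂ (D := n) (Weight.ofPartition N μ'))
    (isIrrChar_spechtCharacter μ) hchar
  have h' := congrArg
    (fun f : highestWeightSpace (wordRep ℂ N n) (Weight.ofPartition N μ') →ₗ[ℂ]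
        highestWeightSpace (wordRep ℂ N n) (Weight.ofPartition N μ') =>
      ((f ⟨ξ, hξ⟩ : highestWeightSpace (wordRep ℂ N n) (Weight.ofPartition N μ')) : Word N n → ℂ)) h
  simp only [LinearMap.zero_apply, Submodule.coe_zero, coe_isotypicProj_hwPermRep] at h'
  exact h'

/-- The isotypic projectors of `𝔖ₙ` commute with the action of `GL_N` on the word model (the two
actions commute, `wordPerm_wordRep`). [cite: FultonHarrisGTM129, Lemma 6.22] -/
theorem isotypicProj_wordRep_comm (φ : Equiv.Perm (Fin n) → ℂ) (g : GL (Fin N) ℂ)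
    (v : Word N n → ℂ) :
    isotypicProj (wordPermRep ℂ N n) φ (wordRep ℂ N n g v) =
      wordRep ℂ N n g (isotypicProj (wordPermRep ℂ N n) φ v) := by
  have h := comp_isotypicProj_of_forall_comm (wordPermRep ℂ N n) φ (T := wordRep ℂ N n g)
    (fun t => LinearMap.ext fun c => by
      simp only [LinearMap.coe_comp, Function.comp_apply, wordPermRep_apply]
      exact (wordPerm_wordRep ℂ t g c).symm)
  exact (LinearMap.congr_fun h v).symm

/-! ### Highest-weight spaces of truncated partitions vanish -/

/-- Dropping parts decreases the sum: if a list of positive naturals has more than `N` entries,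
the sum of its first `N` zero-padded entries is less than its sum. [folklore] -/
theorem sum_getD_lt_sum {N : ℕ} (l : List ℕ) (hl : N < l.length) (hpos : ∀ a ∈ l, 0 < a) :
    ∑ i : Fin N, ((l.getD i 0 : ℕ) : ℤ) < (l.sum : ℤ) := by
  have hsum : (l.sum : ℤ) = ∑ i ∈ Finset.range l.length, ((l.getD i 0 : ℕ) : ℤ) := by
    rw [← Fin.sum_univ_eq_sum_range (fun i => ((l.getD i 0 : ℕ) : ℤ)), Nat.cast_list_sum,
      ← Fin.sum_univ_fun_getElem]
    exact Finset.sum_congr rfl fun i _ => by rw [List.getD_eq_getElem _ _ i.2]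
  rw [hsum, Fin.sum_univ_eq_sum_range (fun i => ((l.getD i 0 : ℕ) : ℤ)) N]
  refine Finset.sum_lt_sum_of_subset (Finset.range_subset_range.2 hl.le) (i := N)
    (Finset.mem_range.2 hl) (by simp) ?_ fun j _ _ => by positivity
  rw [List.getD_eq_getElem _ _ hl]
  exact_mod_cast hpos _ (List.getElem_mem hl)

/-- **No highest-weight vectors for partitions with more than `N` parts.** If `λ ⊢ n` has more
than `N` parts then `HW_{(λ₁,…,λ_N)}((ℂ^N)^{⊗n}) = 0`: a nonzero highest-weight space of the word
model has a weight of size `n` (`size_eq_of_hasHighestWeight_glTensorRep`), whereas the truncated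
weight `(λ₁, …, λ_N)` has size `< n`. (Fulton–Harris Thm. 6.3 (1): `S_λ V = 0` if
`λ_{d+1} ≠ 0`.) [cite: FultonHarrisGTM129, Thm. 6.3 (1)] -/
theorem highestWeightSpace_ofPartition_eq_bot_of_lt {μ : Nat.Partition n} (hμ : N < μ.parts.card) :
    highestWeightSpace (wordRep ℂ N n) (Weight.ofPartition N μ) = ⊥ := by
  by_contra h
  have h' : HasHighestWeight (glTensorRep (Fin N) ℂ n) (Weight.ofPartition N μ) := by
    rw [hasHighestWeight_congr (wordRepEquiv ℂ N n)]
    exact h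
  have hsize := size_eq_of_hasHighestWeight_glTensorRep h'
  have hlt : (Weight.ofPartition N μ).size < (n : ℤ) := by
    change ∑ i : Fin N, ((μ.sortedParts.getD i 0 : ℕ) : ℤ) < n
    have := sum_getD_lt_sum μ.sortedParts (by simpa using hμ) fun a ha => μ.pos_of_mem_sortedParts ha
    simpa [μ.sum_sortedParts] using this
  exact hlt.ne hsize

/-! ### The span of the `GL_N`-translates of `HW_λ` -/

/-- The span `M_λ` of the translates `g · ξ` (`g ∈ GL_N`, `ξ ∈ HW_λ`) is stable under `GL_N`.
[folklore] -/
theorem wordRep_mem_span_of_mem (μ : Nat.Partition n) (g : GL (Fin N) ℂ) {v : Word N n → ℂ}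
    (hv : v ∈ Submodule.span ℂ (Set.range fun p : GL (Fin N) ℂ ×
        highestWeightSpace (wordRep ℂ N n) (Weight.ofPartition N μ) =>
          wordRep ℂ N n p.1 (p.2 : Word N n → ℂ))) :
    wordRep ℂ N n g v ∈ Submodule.span ℂ (Set.range fun p : GL (Fin N) ℂ ×
        highestWeightSpace (wordRep ℂ N n) (Weight.ofPartition N μ) =>
          wordRep ℂ N n p.1 (p.2 : Word N n → ℂ)) := by
  refine Submodule.span_induction (p := fun v _ => wordRep ℂ N n g v ∈ Submodule.span ℂ
      (Set.range fun p : GL (Fin N) ℂ × highestWeightSpace (wordRep ℂ N n) (Weight.ofPartition N μ) =>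
        wordRep ℂ N n p.1 (p.2 : Word N n → ℂ))) ?_ ?_ ?_ ?_ hv
  · rintro _ ⟨⟨h, ξ⟩, rfl⟩
    refine Submodule.subset_span ⟨⟨g * h, ξ⟩, ?_⟩
    simp only [map_mul, Module.End.mul_apply]
  · simp
  · intro x y _ _ hx hy
    rw [map_add]
    exact Submodule.add_mem _ hx hy
  · intro a x _ hx
    rw [map_smul]
    exact Submodule.smul_mem _ a hx

/-- Highest-weight vectors lie in the span of the translates (`g = 1`). [folklore] -/
theorem mem_span_of_mem_highestWeightSpace (μ : Nat.Partition n) {ξ : Word N n → ℂ}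
    (hξ : ξ ∈ highestWeightSpace (wordRep ℂ N n) (Weight.ofPartition N μ)) :
    ξ ∈ Submodule.span ℂ (Set.range fun p : GL (Fin N) ℂ ×
        highestWeightSpace (wordRep ℂ N n) (Weight.ofPartition N μ) =>
          wordRep ℂ N n p.1 (p.2 : Word N n → ℂ)) :=
  Submodule.subset_span ⟨⟨1, ⟨ξ, hξ⟩⟩, by simp⟩

/-- **`P_λ = 1` on the span `M_λ` of the `GL_N`-translates of `HW_λ`** (`λ` with at most `N`
parts): `P_λ` commutes with `GL_N` and fixes `HW_λ`.
[cite: FultonHarrisGTM129, Thm. 6.3 (2) with Lemma 6.22] -/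
theorem isotypicProj_apply_eq_self_of_mem_span (μ : Nat.Partition n) (hμ : μ.parts.card ≤ N)
    {v : Word N n → ℂ}
    (hv : v ∈ Submodule.span ℂ (Set.range fun p : GL (Fin N) ℂ ×
        highestWeightSpace (wordRep ℂ N n) (Weight.ofPartition N μ) =>
          wordRep ℂ N n p.1 (p.2 : Word N n → ℂ))) :
    isotypicProj (wordPermRep ℂ N n) (spechtCharacter ℂ μ) v = v := by
  refine Submodule.span_induction
    (p := fun v _ => isotypicProj (wordPermRep ℂ N n) (spechtCharacter ℂ μ) v = v) ?_ ?_ ?_ ?_ hv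
  · rintro _ ⟨⟨g, ξ⟩, rfl⟩
    simp only
    rw [isotypicProj_wordRep_comm, isotypicProj_apply_of_mem_highestWeightSpace μ hμ ξ.2]
  · simp
  · intro x y _ _ hx hy
    rw [map_add, hx, hy]
  · intro a x _ hx
    rw [map_smul, hx]

/-- **`P_μ = 0` on the span `M_λ`** for `μ ≠ λ` (`λ` with at most `N` parts).
[cite: FultonHarrisGTM129, Thm. 6.3 (2) with Lemma 6.22] -/
theorem isotypicProj_apply_eq_zero_of_mem_span {μ μ' : Nat.Partition n} (hne : μ ≠ μ')
    (hμ' : μ'.parts.card ≤ N) {v : Word N n → ℂ}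
    (hv : v ∈ Submodule.span ℂ (Set.range fun p : GL (Fin N) ℂ ×
        highestWeightSpace (wordRep ℂ N n) (Weight.ofPartition N μ') =>
          wordRep ℂ N n p.1 (p.2 : Word N n → ℂ))) :
    isotypicProj (wordPermRep ℂ N n) (spechtCharacter ℂ μ) v = 0 := by
  refine Submodule.span_induction
    (p := fun v _ => isotypicProj (wordPermRep ℂ N n) (spechtCharacter ℂ μ) v = 0) ?_ ?_ ?_ ?_ hv
  · rintro _ ⟨⟨g, ξ⟩, rfl⟩
    simp only
    rw [isotypicProj_wordRep_comm, isotypicProj_apply_of_mem_highestWeightSpace_of_ne hne hμ' ξ.2,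
      map_zero]
  · simp
  · intro x y _ _ hx hy
    rw [map_add, hx, hy, add_zero]
  · intro a x _ hx
    rw [map_smul, hx, smul_zero]

/-- **Every vector fixed by `P_λ` lies in the span `M_λ` of the `GL_N`-translates of `HW_λ`.**
The fixed space `I_λ` of `P_λ` is `GL_N`-stable and a rational representation of `GL_N`, hence
completely reducible; a `GL_N`-stable complement of `M_λ` in `I_λ` contains, if nonzero, a nonzero
highest-weight vector, whose weight is a partition `μ` with at most `N` parts; being fixed by
`P_λ` forces `μ = λ`, so the vector lies in `HW_λ ⊆ M_λ` — a contradiction. (Fulton–Harris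
Thm. 6.3 (2),(4): `V^{⊗n} ≅ ⊕ S_λV ⊗ V_λ` with `S_λ V` irreducible, generated by its highest-weight
vector.) [cite: FultonHarrisGTM129, Thm. 6.3 (2),(4) with Thm. 15.47] -/
theorem mem_span_of_isotypicProj_apply_eq_self (μ : Nat.Partition n) {v : Word N n → ℂ}
    (hv : isotypicProj (wordPermRep ℂ N n) (spechtCharacter ℂ μ) v = v) :
    v ∈ Submodule.span ℂ (Set.range fun p : GL (Fin N) ℂ ×
        highestWeightSpace (wordRep ℂ N n) (Weight.ofPartition N μ) =>
          wordRep ℂ N n p.1 (p.2 : Word N n → ℂ)) := by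
  classical
  set P := isotypicProj (wordPermRep ℂ N n) (spechtCharacter ℂ μ) with hP
  set M : Submodule ℂ (Word N n → ℂ) := Submodule.span ℂ (Set.range fun p : GL (Fin N) ℂ ×
        highestWeightSpace (wordRep ℂ N n) (Weight.ofPartition N μ) =>
          wordRep ℂ N n p.1 (p.2 : Word N n → ℂ)) with hM
  -- the fixed space of `P` as a `GL_N`-subrepresentation of the word model
  let I : Subrepresentation (wordRep ℂ N n) :=
    ⟨LinearMap.ker (P - LinearMap.id), fun g w hw => by
      rw [LinearMap.mem_ker, LinearMap.sub_apply, LinearMap.id_apply, sub_eq_zero] at hw ⊢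
      rw [hP, isotypicProj_wordRep_comm, ← hP, hw]⟩
  have hmemI : ∀ w, w ∈ I.toSubmodule ↔ P w = w := fun w => by
    change w ∈ LinearMap.ker (P - LinearMap.id) ↔ _
    rw [LinearMap.mem_ker, LinearMap.sub_apply, LinearMap.id_apply, sub_eq_zero]
  have hvI : v ∈ I.toSubmodule := (hmemI v).2 hv
  -- in the truncated case there is nothing to prove: `P` has no nonzero fixed vector (below);
  -- in general we argue inside `I`
  have hIrat : IsRationalRep I.toRepresentation :=
    (isPolynomialRep_wordRep ℂ).isRationalRep.toRepresentation I
  have hss : I.toRepresentation.IsSemisimpleRepresentation :=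
    isSemisimpleRepresentation_of_isRationalRep_holds hIrat
  -- `M ∩ I` as a subrepresentation of `I` (in fact `M ⊆ I` when `λ` has at most `N` parts)
  let M' : Subrepresentation I.toRepresentation :=
    ⟨M.comap I.toSubmodule.subtype, fun g w hw => by
      simp only [Submodule.mem_comap, Submodule.coe_subtype] at hw ⊢
      exact wordRep_mem_span_of_mem μ g hw⟩
  obtain ⟨C, hC⟩ := hss.exists_isCompl M'
  -- the complement is zero
  have hCbot : C = ⊥ := by
    by_contra hC0
    set CU : Submodule ℂ (Word N n → ℂ) := C.toSubmodule.map I.toSubmodule.subtype with hCU_def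
    have hCU : ∀ g, CU ≤ CU.comap (wordRep ℂ N n g) := by
      rintro g _ ⟨c, hc, rfl⟩
      rw [Submodule.mem_comap]
      exact ⟨I.toRepresentation g c, C.apply_mem_toSubmodule g hc, rfl⟩
    have hCU0 : CU ≠ ⊥ := by
      intro hbot
      apply hC0
      apply Subrepresentation.toSubmodule_injective
      change C.toSubmodule = ⊥
      rw [hCU_def, ← Submodule.map_bot I.toSubmodule.subtype] at hbot
      exact Submodule.map_injective_of_injective I.toSubmodule.injective_subtype hbot
    obtain ⟨χ, w, hwC, hw0, hwHW⟩ := exists_mem_highestWeightSpace_of_le_comap CU hCU hCU0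
    obtain ⟨μ', hμ'N, hμ'χ⟩ := exists_partition_of_highestWeightSpace_ne_bot (k := ℂ) (χ := χ)
      ((Submodule.ne_bot_iff _).2 ⟨w, hwHW, hw0⟩)
    subst hμ'χ
    obtain ⟨c, hcC, hcw⟩ := Submodule.mem_map.1 hwC
    have hwI : P w = w := (hmemI w).1 (hcw ▸ c.2)
    by_cases hμμ' : μ = μ'
    · subst hμμ'
      have hwM : w ∈ M := mem_span_of_mem_highestWeightSpace μ hwHW
      have hcw' : (c : Word N n → ℂ) = w := hcw
      have hcM' : c ∈ M'.toSubmodule := by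
        change c ∈ M.comap I.toSubmodule.subtype
        rw [Submodule.mem_comap, Submodule.coe_subtype, hcw']
        exact hwM
      have hc0 : c ∈ (M' ⊓ C).toSubmodule := ⟨hcM', hcC⟩
      rw [disjoint_iff.1 hC.disjoint] at hc0
      have hc0' : c = 0 := hc0
      apply hw0
      rw [← hcw, hc0']
      rfl
    · apply hw0
      rw [← hwI]
      exact isotypicProj_apply_of_mem_highestWeightSpace_of_ne hμμ' hμ'N hwHW
  -- hence `M' = ⊤`, i.e. `I ⊆ M`
  have hM'top : M' = ⊤ := by
    have := hC.sup_eq_top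
    rwa [hCbot, sup_bot_eq] at this
  have hvM' : (⟨v, hvI⟩ : I.toSubmodule) ∈ M'.toSubmodule := by
    rw [hM'top]
    trivial
  simpa [M', Submodule.mem_comap] using hvM'

/-- **The `λ`-isotypic component is the span of the `GL_N`-translates of `HW_λ`** (Schur–Weyl
duality, span form): for every `λ ⊢ n`, `P_λ (ℂ^N)^{⊗n} = span {g · ξ | g ∈ GL_N, ξ ∈ HW_λ}` in the
word model. (Fulton–Harris Thm. 6.3: `V^{⊗n} ≅ ⊕_λ S_λV ⊗ V_λ`, `S_λV` irreducible with highest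
weight `λ`; CVZ §3.1 (sw).) [cite: FultonHarrisGTM129, Thm. 6.3 (2),(4) with Thm. 15.47] -/
theorem range_isotypicProj_wordPermRep (μ : Nat.Partition n) :
    LinearMap.range (isotypicProj (wordPermRep ℂ N n) (spechtCharacter ℂ μ)) =
      Submodule.span ℂ (Set.range fun p : GL (Fin N) ℂ ×
        highestWeightSpace (wordRep ℂ N n) (Weight.ofPartition N μ) =>
          wordRep ℂ N n p.1 (p.2 : Word N n → ℂ)) := by
  apply le_antisymm
  · rintro _ ⟨v, rfl⟩
    exact mem_span_of_isotypicProj_apply_eq_self μ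
      (isotypicProj_isotypicProj_apply _ (isIrrChar_spechtCharacter μ) v)
  · intro v hv
    by_cases hμ : μ.parts.card ≤ N
    · exact ⟨v, isotypicProj_apply_eq_self_of_mem_span μ hμ hv⟩
    · have hbot : highestWeightSpace (wordRep ℂ N n) (Weight.ofPartition N μ) = ⊥ :=
        highestWeightSpace_ofPartition_eq_bot_of_lt (not_le.1 hμ)
      have hv0 : v = 0 := by
        refine (Submodule.mem_bot ℂ).1 ((Submodule.span_le.2 ?_) hv)
        rintro _ ⟨⟨g, ξ⟩, rfl⟩
        have hξ : (ξ : Word N n → ℂ) = 0 := (Submodule.eq_bot_iff _).1 hbot _ ξ.2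
        simp [hξ]
      rw [hv0]
      exact Submodule.zero_mem _

/-- **Schur–Weyl vanishing**: the isotypic projector `P_λ` of `𝔖ₙ` on `(ℂ^N)^{⊗n}` vanishes when
`λ` has more than `N` parts (`S_λ(ℂ^N) = 0` for `ℓ(λ) > N`; Fulton–Harris Thm. 6.3 (1); CVZ §3.1
(sw): "`S_λ(V)` … is `0` otherwise"). [cite: FultonHarrisGTM129, Thm. 6.3 (1)] -/
theorem isotypicProj_wordPermRep_eq_zero_of_lt {μ : Nat.Partition n} (hμ : N < μ.parts.card) :
    isotypicProj (wordPermRep ℂ N n) (spechtCharacter ℂ μ) = 0 := by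
  have hbot : highestWeightSpace (wordRep ℂ N n) (Weight.ofPartition N μ) = ⊥ :=
    highestWeightSpace_ofPartition_eq_bot_of_lt hμ
  have hrange : LinearMap.range (isotypicProj (wordPermRep ℂ N n) (spechtCharacter ℂ μ)) = ⊥ := by
    rw [range_isotypicProj_wordPermRep, Submodule.span_eq_bot]
    rintro _ ⟨⟨g, ξ⟩, rfl⟩
    have hξ : (ξ : Word N n → ℂ) = 0 := (Submodule.eq_bot_iff _).1 hbot _ ξ.2
    simp [hξ]
  exact LinearMap.range_eq_bot.1 hrange

/-- A nonzero vector in the `λ`-isotypic component forces `λ` to have at most `N` parts.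
[cite: FultonHarrisGTM129, Thm. 6.3 (1)] -/
theorem card_parts_le_of_isotypicProj_apply_ne_zero {μ : Nat.Partition n} {v : Word N n → ℂ}
    (hv : isotypicProj (wordPermRep ℂ N n) (spechtCharacter ℂ μ) v ≠ 0) : μ.parts.card ≤ N := by
  by_contra h
  exact hv (by rw [isotypicProj_wordPermRep_eq_zero_of_lt (not_le.1 h), LinearMap.zero_apply])

end Literature.RepresentationTheory.GeneralLinear

end
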